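import Summits.BirchSwinnertonDyer.BirchSwinnertonDyer.Theorems.Rank2ObservatoryKernelWalker
import Mathlib.NumberTheory.LegendreSymbol.QuadraticChar.Basic
import HarnessLib

/-!
# BirchSwinnertonDyer — rank ≥ 2 observatory: Euler-criterion point counts in the kernel

HONEST FRAMING: per-curve certified theorems and census instruments; no claim on BSD in rank ≥ 2.

A FASTER kernel point count. `zmodPointCount V q` (`Rank2ObservatoryKernelAnnihilator`) filters all
`q²` pairs of `(ZMod q)²`; for an odd prime `q` the number of `y` with
`y² + (a₁x + a₃)y = x³ + a₂x² + a₄x + a₆` is `1 + χ(D(x))` with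
`D(x) = (a₁x + a₃)² + 4(x³ + a₂x² + a₄x + a₆)` and `χ` the quadratic character, which Euler's
criterion evaluates as `D^((q−1)/2) mod q` — `q` accelerated `Nat.pow`/`Nat.mod` evaluations
instead of `q²` ring evaluations in `ZMod q` (Cremona, *Algorithms* §2.4 counts exactly this way).
Contents:

* `eulerSqrtCount q D` (number of square roots of `D` mod `q` by Euler's criterion), `discY`,
  `legendreCountAux`, `redMod`, `legendrePointCount V q` — pure `ℕ` arithmetic, kernel-evaluable;
* **`legendrePointCount_eq_zmodPointCount`**: for a prime `q ≠ 2` the fast count IS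
  `zmodPointCount V q`
  (fiberwise count `Finset.card_filter` / `Fintype.sum_prod_type`, completing the square by the
  bijection `y ↦ 2y + (a₁x + a₃)`, Mathlib's `quadraticChar_card_sqrts` and
  `quadraticChar_eq_pow_of_char_ne_two`);
* `killerLB V (ℓ, N)` — the drop-in replacement of `KernelWalker.killerB` (good prime `ℓ` and
  `#Ẽ(𝔽_ℓ) = N`, counted by `legendrePointCount` for `ℓ ≠ 2`, by `zmodPointCount` for `ℓ = 2`) with
  `killerB_of_killerLB` / `all_killerB_of_all_killerLB`, so every soundness theorem stated over
  `killerB` applies verbatim to certificates checked with `killerLB`.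

Sorry-free; no `decide` executed in this file; axioms `propext`, `Classical.choice`, `Quot.sound`.

References: J. E. Cremona, *Algorithms for Modular Elliptic Curves* (1997) §2.4;
J. H. Silverman, *The Arithmetic of Elliptic Curves* (2009) V.1; K. Ireland, M. Rosen,
*A Classical Introduction to Modern Number Theory* (1990) Prop. 5.1.2 (Euler's criterion).
-/

-- single-conjunct summit: `Summit.BirchSwinnertonDyer.BirchSwinnertonDyer.…` repeats the name
set_option linter.dupNamespace false

namespace Summit.BirchSwinnertonDyer.BirchSwinnertonDyer.Rank2Observatory

open WeierstrassCurve Finset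

/-! ### The computing functions (pure `ℕ` arithmetic) -/

/-- Number of `z mod q` with `z² ≡ D`, for an odd prime `q`, by EULER'S CRITERION:
`1` if `q ∣ D`, `2` if `D^((q-1)/2) ≡ 1`, else `0`. [cite: CremonaAlgorithms1997, §2.4] -/
def eulerSqrtCount (q D : ℕ) : ℕ :=
  if D % q = 0 then 1 else if D ^ (q / 2) % q = 1 then 2 else 0

/-- The discriminant in `y` of the Weierstrass equation at the abscissa `x` (coefficients already
reduced to naturals): `D(x) = (a₁x + a₃)² + 4(x³ + a₂x² + a₄x + a₆) mod q`.
[cite: CremonaAlgorithms1997, §2.4] -/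
def discY (q a₁ a₂ a₃ a₄ a₆ x : ℕ) : ℕ :=
  ((a₁ * x + a₃) ^ 2 + 4 * (x ^ 3 + a₂ * x ^ 2 + a₄ * x + a₆)) % q

/-- `∑_{x < n} eulerSqrtCount q (D(x))` by structural recursion.
[cite: CremonaAlgorithms1997, §2.4] -/
def legendreCountAux (q a₁ a₂ a₃ a₄ a₆ : ℕ) : ℕ → ℕ
  | 0 => 0
  | x + 1 => legendreCountAux q a₁ a₂ a₃ a₄ a₆ x + eulerSqrtCount q (discY q a₁ a₂ a₃ a₄ a₆ x)

/-- An integer coefficient reduced to `[0, q)`. [folklore] -/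
def redMod (q : ℕ) (a : ℤ) : ℕ := (a % (q : ℤ)).toNat

/-- **The fast point count** `#Ẽ(𝔽_q) = q + 1 + ∑_x χ(D(x))`, written as
`1 + ∑_{x < q} eulerSqrtCount q (D(x))`. [cite: CremonaAlgorithms1997, §2.4] -/
def legendrePointCount (V : WeierstrassCurve ℤ) (q : ℕ) : ℕ :=
  legendreCountAux q (redMod q V.a₁) (redMod q V.a₂) (redMod q V.a₃) (redMod q V.a₄)
    (redMod q V.a₆) q + 1

/-! ### Correctness -/

/-- The recursion is the sum over `Finset.range`. [folklore] -/
theorem legendreCountAux_eq_sum (q a₁ a₂ a₃ a₄ a₆ n : ℕ) :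
    legendreCountAux q a₁ a₂ a₃ a₄ a₆ n =
      ∑ x ∈ Finset.range n, eulerSqrtCount q (discY q a₁ a₂ a₃ a₄ a₆ x) := by
  induction n with
  | zero => simp [legendreCountAux]
  | succ n ih => rw [legendreCountAux, ih, Finset.sum_range_succ]

/-- The reduced coefficient casts back to the integer in `ZMod q`. [folklore] -/
theorem natCast_redMod (q : ℕ) [NeZero q] (a : ℤ) : ((redMod q a : ℕ) : ZMod q) = (a : ZMod q) := by
  have h0 : 0 ≤ a % (q : ℤ) := Int.emod_nonneg a (by exact_mod_cast NeZero.ne q)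
  have h1 : ((redMod q a : ℕ) : ℤ) = a % (q : ℤ) := by
    rw [redMod, Int.toNat_of_nonneg h0]
  rw [← Int.cast_natCast, h1, ZMod.intCast_mod]

section Field

variable {q : ℕ} [Fact q.Prime]

/-- `Euler's criterion` in the shape of `eulerSqrtCount`: for an odd prime `q` and `D : ℕ`,
`eulerSqrtCount q D = χ(D) + 1` with `χ` the quadratic character of `ZMod q`.
[cite: CremonaAlgorithms1997, §2.4] -/
theorem eulerSqrtCount_eq_quadraticChar (hq2 : q ≠ 2) (D : ℕ) :
    (eulerSqrtCount q D : ℤ) = quadraticChar (ZMod q) (D : ZMod q) + 1 := by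
  have hq : q.Prime := Fact.out
  have hF : ringChar (ZMod q) ≠ 2 := by rwa [ZMod.ringChar_zmod_n]
  unfold eulerSqrtCount
  by_cases hD : D % q = 0
  · have hz : (D : ZMod q) = 0 := (ZMod.natCast_eq_zero_iff D q).mpr (Nat.dvd_of_mod_eq_zero hD)
    simp [hD, hz]
  · have hz : (D : ZMod q) ≠ 0 := fun h =>
      hD (Nat.mod_eq_zero_of_dvd ((ZMod.natCast_eq_zero_iff D q).mp h))
    rw [if_neg hD, quadraticChar_eq_pow_of_char_ne_two hF hz, ZMod.card q]
    have hiff : (D : ZMod q) ^ (q / 2) = 1 ↔ D ^ (q / 2) % q = 1 := by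
      rw [show ((D : ZMod q) ^ (q / 2) = 1) ↔ (((D ^ (q / 2) : ℕ) : ZMod q) = ((1 : ℕ) : ZMod q))
        by push_cast; exact Iff.rfl, ZMod.natCast_eq_natCast_iff', Nat.mod_eq_of_lt hq.one_lt]
    by_cases h1 : D ^ (q / 2) % q = 1
    · rw [if_pos h1, if_pos (hiff.mpr h1)]; norm_num
    · rw [if_neg h1, if_neg (fun h => h1 (hiff.mp h))]; norm_num

/-- Completing the square: over `ZMod q`, `q` an odd prime, the number of `y` with
`y² + l·y = f` equals the number of `z` with `z² = l² + 4f` (`z = 2y + l`).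
[cite: CremonaAlgorithms1997, §2.4] -/
theorem card_filter_sq_add_eq (hq2 : q ≠ 2) (l f : ZMod q) :
    #(univ.filter fun y : ZMod q => y ^ 2 + l * y = f) =
      #(univ.filter fun z : ZMod q => z ^ 2 = l ^ 2 + 4 * f) := by
  have hF : ringChar (ZMod q) ≠ 2 := by rwa [ZMod.ringChar_zmod_n]
  have h2 : (2 : ZMod q) ≠ 0 := Ring.two_ne_zero hF
  have h4 : (4 : ZMod q) ≠ 0 := by
    have : (4 : ZMod q) = 2 * 2 := by norm_num
    rw [this]; exact mul_ne_zero h2 h2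
  refine card_bijective (fun y : ZMod q => 2 * y + l) ?_ ?_
  · constructor
    · intro a b h
      have : (2 : ZMod q) * a = 2 * b := by
        have := h; dsimp only at this; exact add_right_cancel this
      exact mul_left_cancel₀ h2 this
    · intro z
      refine ⟨(z - l) * (2 : ZMod q)⁻¹, ?_⟩
      dsimp only
      rw [mul_comm, mul_assoc, inv_mul_cancel₀ h2, mul_one, sub_add_cancel]
  · intro y
    simp only [mem_filter, mem_univ, true_and]
    constructor
    · intro h; linear_combination 4 * h
    · intro h
      refine mul_left_cancel₀ h4 ?_
      linear_combination h

/-- The `y`-fibre of the point count at an abscissa `x`: its size is `χ(D(x)) + 1`.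
[cite: CremonaAlgorithms1997, §2.4] -/
theorem card_fibre_eq (hq2 : q ≠ 2) (a₁ a₂ a₃ a₄ a₆ x : ZMod q) :
    (#(univ.filter fun y : ZMod q =>
        y ^ 2 + a₁ * x * y + a₃ * y = x ^ 3 + a₂ * x ^ 2 + a₄ * x + a₆) : ℤ) =
      quadraticChar (ZMod q) ((a₁ * x + a₃) ^ 2 + 4 * (x ^ 3 + a₂ * x ^ 2 + a₄ * x + a₆)) + 1 := by
  classical
  have hF : ringChar (ZMod q) ≠ 2 := by rwa [ZMod.ringChar_zmod_n]
  have h1 : (univ.filter fun y : ZMod q =>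
      y ^ 2 + a₁ * x * y + a₃ * y = x ^ 3 + a₂ * x ^ 2 + a₄ * x + a₆) =
      (univ.filter fun y : ZMod q =>
        y ^ 2 + (a₁ * x + a₃) * y = x ^ 3 + a₂ * x ^ 2 + a₄ * x + a₆) := by
    refine filter_congr fun y _ => ?_
    rw [show y ^ 2 + a₁ * x * y + a₃ * y = y ^ 2 + (a₁ * x + a₃) * y by ring]
  rw [h1, card_filter_sq_add_eq hq2]
  have key :=
    quadraticChar_card_sqrts hF ((a₁ * x + a₃) ^ 2 + 4 * (x ^ 3 + a₂ * x ^ 2 + a₄ * x + a₆))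
  simp only [Set.toFinset_setOf] at key
  convert key using 3

/-- **The fast count is the kernel count**: `legendrePointCount V q = zmodPointCount V q` for every
prime `q ≠ 2` (so `= Nat.card Ẽ(𝔽_q)` for `q ∤ Δ`, `natCard_point_eq_zmodPointCount`).
[cite: CremonaAlgorithms1997, §2.4] -/
theorem legendrePointCount_eq_zmodPointCount (V : WeierstrassCurve ℤ) (hq2 : q ≠ 2) :
    legendrePointCount V q = zmodPointCount V q := by
  classical
  have hq : q.Prime := Fact.out
  -- fiberwise decomposition of the pair count
  have hpairs : #(univ.filter fun xy : ZMod q × ZMod q =>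
      xy.2 ^ 2 + (V.a₁ : ZMod q) * xy.1 * xy.2 + (V.a₃ : ZMod q) * xy.2 =
        xy.1 ^ 3 + (V.a₂ : ZMod q) * xy.1 ^ 2 + (V.a₄ : ZMod q) * xy.1 + (V.a₆ : ZMod q)) =
      ∑ x : ZMod q, #(univ.filter fun y : ZMod q =>
        y ^ 2 + (V.a₁ : ZMod q) * x * y + (V.a₃ : ZMod q) * y =
          x ^ 3 + (V.a₂ : ZMod q) * x ^ 2 + (V.a₄ : ZMod q) * x + (V.a₆ : ZMod q)) := by
    rw [card_filter, Fintype.sum_prod_type]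
    refine sum_congr rfl fun x _ => ?_
    rw [card_filter]
  -- each fibre is the Euler count of the reduced discriminant
  have hfib : ∀ x : ZMod q, #(univ.filter fun y : ZMod q =>
      y ^ 2 + (V.a₁ : ZMod q) * x * y + (V.a₃ : ZMod q) * y =
        x ^ 3 + (V.a₂ : ZMod q) * x ^ 2 + (V.a₄ : ZMod q) * x + (V.a₆ : ZMod q)) =
      eulerSqrtCount q (discY q (redMod q V.a₁) (redMod q V.a₂) (redMod q V.a₃) (redMod q V.a₄)
        (redMod q V.a₆) x.val) := by
    intro x
    have hD : ((discY q (redMod q V.a₁) (redMod q V.a₂) (redMod q V.a₃) (redMod q V.a₄)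
        (redMod q V.a₆) x.val : ℕ) : ZMod q) =
        ((V.a₁ : ZMod q) * x + (V.a₃ : ZMod q)) ^ 2 +
          4 * (x ^ 3 + (V.a₂ : ZMod q) * x ^ 2 + (V.a₄ : ZMod q) * x + (V.a₆ : ZMod q)) := by
      rw [discY, ZMod.natCast_mod]
      push_cast
      rw [natCast_redMod, natCast_redMod, natCast_redMod, natCast_redMod, natCast_redMod,
        ZMod.natCast_zmod_val]
    have h := card_fibre_eq hq2 (V.a₁ : ZMod q) (V.a₂ : ZMod q) (V.a₃ : ZMod q) (V.a₄ : ZMod q)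
      (V.a₆ : ZMod q) x
    rw [← hD, ← eulerSqrtCount_eq_quadraticChar hq2] at h
    exact_mod_cast h
  -- reindex the sum over `ZMod q` as a sum over `range q`
  have hsum : ∑ x : ZMod q, eulerSqrtCount q (discY q (redMod q V.a₁) (redMod q V.a₂)
      (redMod q V.a₃) (redMod q V.a₄) (redMod q V.a₆) x.val) =
      ∑ n ∈ range q, eulerSqrtCount q (discY q (redMod q V.a₁) (redMod q V.a₂)
        (redMod q V.a₃) (redMod q V.a₄) (redMod q V.a₆) n) := by
    obtain ⟨k, hk⟩ : ∃ k, q = k + 1 := ⟨q - 1, (Nat.succ_pred_eq_of_pos hq.pos).symm⟩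
    subst hk
    exact Fin.sum_univ_eq_sum_range (fun n => eulerSqrtCount (k + 1) (discY (k + 1)
      (redMod (k + 1) V.a₁) (redMod (k + 1) V.a₂) (redMod (k + 1) V.a₃) (redMod (k + 1) V.a₄)
      (redMod (k + 1) V.a₆) n)) (k + 1)
  rw [legendrePointCount, legendreCountAux_eq_sum, zmodPointCount, hpairs,
    Finset.sum_congr rfl fun x _ => hfib x, hsum]

end Field

/-! ### The drop-in killer Boolean -/

/-- One kernel-count killer `(ℓ, N)` (Boolean): `ℓ` a good prime and `#Ẽ(𝔽_ℓ) = N`, the count by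
`legendrePointCount` (Euler's criterion) for `ℓ ≠ 2` and by `zmodPointCount` for `ℓ = 2`.
[cite: CremonaAlgorithms1997, §2.4] -/
def killerLB (V : WeierstrassCurve ℤ) : ℕ × ℕ → Bool
  | (0, _) => false
  | (ℓ + 1, N) => goodPrimeB V (ℓ + 1) &&
      (if ℓ = 1 then zmodPointCount V (ℓ + 1) == N else legendrePointCount V (ℓ + 1) == N)

/-- **`killerLB ⇒ killerB`**: the fast killer Boolean implies the landed one (same prime, same
count by `legendrePointCount_eq_zmodPointCount`). [cite: CremonaAlgorithms1997, §2.4] -/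
theorem killerB_of_killerLB (V : WeierstrassCurve ℤ) {ℓN : ℕ × ℕ} (h : killerLB V ℓN = true) :
    killerB V ℓN = true := by
  obtain ⟨ℓ, N⟩ := ℓN
  cases ℓ with
  | zero => simp [killerLB] at h
  | succ ℓ =>
    rw [killerLB, Bool.and_eq_true] at h
    obtain ⟨hgood, hcount⟩ := h
    rw [killerB, Bool.and_eq_true]
    refine ⟨hgood, ?_⟩
    have hg := hgood
    rw [goodPrimeB, Bool.and_eq_true, decide_eq_true_eq] at hg
    haveI : Fact (ℓ + 1).Prime := ⟨hg.1⟩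
    by_cases h1 : ℓ = 1
    · rw [if_pos h1] at hcount; exact hcount
    · rw [if_neg h1, beq_iff_eq] at hcount
      rw [beq_iff_eq, ← legendrePointCount_eq_zmodPointCount V (q := ℓ + 1) (by omega)]
      exact hcount

/-- List form: `S.all (killerLB V) ⇒ S.all (killerB V)`. [folklore] -/
theorem all_killerB_of_all_killerLB (V : WeierstrassCurve ℤ) {S : List (ℕ × ℕ)}
    (h : S.all (killerLB V) = true) : S.all (killerB V) = true :=
  List.all_eq_true.mpr fun ℓN hmem => killerB_of_killerLB V (List.all_eq_true.mp h ℓN hmem)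

end Summit.BirchSwinnertonDyer.BirchSwinnertonDyer.Rank2Observatory
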